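/-
Copyright (c) 2026 the pub-hodgecm-mathlib formalisation cell (harness21).  Prover seat hodgecm-mathlib-K2Liu-p09 (g7): Track B «K2-LIT»,
hLiu418 = stmt-HodgeConjecture-24832; LEAD F0P6-plan RULINGS M-158d «A7-val road (σ)» and σ19∕σ21 — `hne` organ, brick (N0): the value at `½` does not depend on the
Iwasawa compact `K₀` along which the section is extended flatly.
-/
import Summits.HodgeConjecture.HodgeConjecture.Theorems.K2LiuA7ValueFunctional   -- ★ V1 p859718 (`value_eq_sum`, `apply_eq_cpow_mul_apply`, `absDetDelta_eq_of_mul_eq_mul`; brings ★ B2 `exists_absDetDelta_eq_zpow`, `isQRationalRegularAt_zpow_cpow_add`)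
import HarnessLib

/-!
# Crux `HLiu418`, road `K2_Liu`, organ A7-val, `hne` organ brick (N0): LEVEL INDEPENDENCE OF THE VALUE AT `½`

Cell `hodgecm-mathlib`, crux item hLiu418 = `stmt-HodgeConjecture-24832`; squad K2 ∕ K2Liu; prover K2Liu-p09 (g7), organ lead A7-val.  THEOREMS ONLY; lane
`--supports stmt-HodgeConjecture-24832` (count-neutral helper).  RANK-GENERIC, frame-free, every finite place; HYPOTHESIS-FIRST in the (A4′-R) face (`hA4R`) and the
half-plane integrability (`hintA`) for ONE of the two Iwasawa compacts, exactly as ★ V8a `exists_valueMap`.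

THE POINT.  V8e's witness binder `hne` and the face (A4″-KR) are stated PER Iwasawa compact open `K₀ ≤ H_v` (`H_v = P_Δ(F_v)·K₀`): the section `φ ∈ I_v(½, χ_v)` is extended to
the `K₀`-FLAT family `f_s` and `Fn(½)` is the regular value of `M_v(s) f_s ∕ a_v(s)`.  Two Iwasawa compacts `K₀, K₀′` give two flat families `f, f′` through the same `φ`; this
file proves **`Fn(½) = Fn′(½)`** (`value_level_independent`), so «`φ` carries a witness with non-zero datum at `(½, h₀)`» does not depend on `K₀` — the input that lets the
similitude transport `Ad d_a` (which moves `K₀`) serve the `hne` assembly (σ19).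
PROOF.  With Iwasawa projections `x = p(x)k(x) = p′(x)k′(x)`: `f_s(x) = |det_Δ p(x)|_v^{s−½} φ(x)` and `f′_s(x) = |det_Δ p′(x)|_v^{s−½} φ(x)` (★ V1 `apply_eq_cpow_mul_apply`),
`|det_Δ p(x)|_v = q_v^{K(x)}`, `|det_Δ p′(x)|_v = q_v^{K′(x)}` (★ B2 `exists_absDetDelta_eq_zpow`); `κ := K′ − K : H_v → ℤ` is right-`K₀ ∩ K₀′`-invariant (★ `absDetDelta_eq_of_mul_eq_mul`)
and left-`P_Δ`-invariant (★ `absDetDelta_mul`), hence locally constant with FINITE range `S` (compactness of `K₀′`).  The pieces `f^j_s := f_s · 𝟙_{κ = j}` (`j ∈ S`) are again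
`K₀`-flat smooth Siegel families, so `hA4R` gives data `Fn^j`; `f_s = Σ_j f^j_s` and `f′_s = Σ_j (q_v^j)^{s−½} f^j_s` pointwise, and ★ V1 `value_eq_sum` (linearity of `M_v(s)` on
`1 < re s` + the identity principle) gives `Fn(½) = Σ_j Fn^j(½) = Fn′(½)`.
HONEST LABEL.  `HC_CM` is proved only modulo the 7 printed citations (2 remaining named inputs: hLiu418 = `stmt-HodgeConjecture-24832`,
h413 = `stmt-HodgeConjecture-24833`) until rung 0 closes.

## References
* [KudlaSweet1997] S. Kudla, W. J. Sweet, Israel J. Math. 98 (1997), §1 (the normalised intertwining operator at `s₀` on `I_n(s, χ)`).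
* [Casselman1980] W. Casselman, Compositio Math. 40 (1980), §3 (flat sections along `K`, rationality in `q^{-s}`).
* [BernsteinZelevinsky1976] I. N. Bernstein, A. V. Zelevinsky, Russian Math. Surveys 31 (1976), §1.1 (compact open subgroups, locally constant functions).
-/

set_option autoImplicit false
set_option linter.dupNamespace false -- the mandated namespace repeats `HodgeConjecture.HodgeConjecture`

noncomputable section

open scoped Classical
open NumberField IsDedekindDomain MeasureTheory Topology
open Literature.NumberTheory.GaloisRepresentations.IsNonarchimedeanLocalField
open Literature.NumberTheory.Automorphic Literature.NumberTheory.Automorphic.UnitaryGroup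
open Literature.NumberTheory.GelbartRogawski1991.UnitaryDualPair.LocalSplitting
open Literature.NumberTheory.K2Lit.LocalSiegelDoubled
open Summit.HodgeConjecture.HodgeConjecture.Cruxes.HLiu418.K2LiuQRationalDefs
open Summit.HodgeConjecture.HodgeConjecture.Cruxes.HLiu418.K2LiuLocalLFactorDefs
open Summit.HodgeConjecture.HodgeConjecture.Cruxes.HLiu418.K2LiuLocalSiegel
open Summit.HodgeConjecture.HodgeConjecture.Cruxes.HLiu418.K2LiuFlatSiegelFamilies
open Summit.HodgeConjecture.HodgeConjecture.Cruxes.HLiu418.K2LiuA7ValueFunctional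

namespace Summit.HodgeConjecture.HodgeConjecture.Cruxes.HLiu418.K2LiuA7ValueLevelIndependence

variable (F : Type) [Field F] [NumberField F] (E : Type) [Field E] [NumberField E] [Algebra F E]
  [Algebra.IsQuadraticExtension F E] (c : E ≃ₐ[F] E)
  {δ : E} (hcδ : c δ = -δ) (hδ : δ ≠ 0) {d : F} (hd : δ * δ = algebraMap F E d) (v : HeightOneSpectrum (𝓞 F)) (n : ℕ)
  {T₀ : Matrix (Fin n) (Fin n) F} (hT₀ : T₀.IsSymm) {JD : Matrix (Fin (n + n)) (Fin (n + n)) E} (hJD : JD = (gramD F n T₀).map (algebraMap F E))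
  (χv : ∀ w : PlacesOver E v, (w.1.adicCompletion E)ˣ →* ℂˣ)
  [MeasurableSpace (unipDeltaLocal F E c v n (JD := JD))] (νN : Measure (unipDeltaLocal F E c v n (JD := JD))) (vol : ℝ)
  (haN : ∀ s : ℂ, 1 < s.re → aNorm F E c v n χv vol s ≠ 0)
  (K₀ K₀' : Subgroup (UnitaryGroup.localPi E c (n + n) JD v))
  (hK₀ : IsCompact (K₀ : Set (UnitaryGroup.localPi E c (n + n) JD v)) ∧ IsOpen (K₀ : Set (UnitaryGroup.localPi E c (n + n) JD v)))
  (hK₀' : IsCompact (K₀' : Set (UnitaryGroup.localPi E c (n + n) JD v)) ∧ IsOpen (K₀' : Set (UnitaryGroup.localPi E c (n + n) JD v)))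
  (hIw : ∀ x : UnitaryGroup.localPi E c (n + n) JD v, ∃ p, IsSiegelDelta F E c hcδ hδ hd v n hT₀ hJD p ∧ ∃ k ∈ K₀, x = p * k)
  (hIw' : ∀ x : UnitaryGroup.localPi E c (n + n) JD v, ∃ p, IsSiegelDelta F E c hcδ hδ hd v n hT₀ hJD p ∧ ∃ k ∈ K₀', x = p * k)
  -- the (A4′-R) face in ∀∃-shape and the half-plane integrability, for `K₀`-flat families (★ A7-reg ∕ ★ V1c), as ★ V8a
  (hA4R : ∀ f' : ℂ → UnitaryGroup.localPi E c (n + n) JD v → ℂ, (∀ s, IsLocalSiegelSection F E c hcδ hδ hd v n hT₀ hJD χv s (f' s)) →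
    (∀ s, IsSmooth F E c v n (f' s)) → (∀ s s' : ℂ, ∀ k ∈ K₀, f' s k = f' s' k) →
    ∃ Fn' : ℂ → UnitaryGroup.localPi E c (n + n) JD v → ℂ, (∀ h, IsQRationalRegularAt (residueFieldCard (v.adicCompletion F)) (1 / 2) fun s => Fn' s h) ∧
      ∀ s : ℂ, 1 < s.re → ∀ h, localIntertwining F E c v n hJD νN (f' s) h = aNorm F E c v n χv vol s * Fn' s h)
  (hintA : ∀ f' : ℂ → UnitaryGroup.localPi E c (n + n) JD v → ℂ, (∀ s, IsLocalSiegelSection F E c hcδ hδ hd v n hT₀ hJD χv s (f' s)) →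
    (∀ s, IsSmooth F E c v n (f' s)) → (∀ s s' : ℂ, ∀ k ∈ K₀, f' s k = f' s' k) → ∀ s : ℂ, 1 < s.re → ∀ h,
      Integrable (fun u : unipDeltaLocal F E c v n (JD := JD) => f' s (weylDelta F E c v n hJD * (u : UnitaryGroup.localPi E c (n + n) JD v) * h)) νN)

include hcδ hδ hd hT₀ hJD hK₀ hK₀' hIw hIw' hA4R hintA haN in
/-- **LEVEL INDEPENDENCE OF THE VALUE AT `½`.**  Let `K₀, K₀′ ≤ H_v` be Iwasawa compact opens, `(f, Fn)` a `K₀`-flat smooth Siegel family with (A4′-R) datum and `(f′, Fn′)`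
a `K₀′`-flat Siegel family with (A4′-R) datum, through the SAME section `f′(½) = f(½)`.  Then `Fn(½) = Fn′(½)`. [cite: KudlaSweet1997, §1] [cite: Casselman1980, §3]
[cite: BernsteinZelevinsky1976, §1.1] -/
theorem value_level_independent
    (f Fn : ℂ → UnitaryGroup.localPi E c (n + n) JD v → ℂ)
    (hS : ∀ s, IsLocalSiegelSection F E c hcδ hδ hd v n hT₀ hJD χv s (f s)) (hsm : ∀ s, IsSmooth F E c v n (f s))
    (hfl : ∀ s s' : ℂ, ∀ k ∈ K₀, f s k = f s' k)
    (hreg : ∀ h, IsQRationalRegularAt (residueFieldCard (v.adicCompletion F)) (1 / 2) fun s => Fn s h)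
    (hfac : ∀ s : ℂ, 1 < s.re → ∀ h, localIntertwining F E c v n hJD νN (f s) h = aNorm F E c v n χv vol s * Fn s h)
    (f' Fn' : ℂ → UnitaryGroup.localPi E c (n + n) JD v → ℂ)
    (hS' : ∀ s, IsLocalSiegelSection F E c hcδ hδ hd v n hT₀ hJD χv s (f' s))
    (hfl' : ∀ s s' : ℂ, ∀ k ∈ K₀', f' s k = f' s' k)
    (hreg' : ∀ h, IsQRationalRegularAt (residueFieldCard (v.adicCompletion F)) (1 / 2) fun s => Fn' s h)
    (hfac' : ∀ s : ℂ, 1 < s.re → ∀ h, localIntertwining F E c v n hJD νN (f' s) h = aNorm F E c v n χv vol s * Fn' s h)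
    (heq : f' (1 / 2) = f (1 / 2)) (h : UnitaryGroup.localPi E c (n + n) JD v) :
    Fn (1 / 2) h = Fn' (1 / 2) h := by
  -- Iwasawa projections for the two compacts and the integer exponents of the heights
  choose pI hpI kI hkI hxI using hIw
  choose pI' hpI' kI' hkI' hxI' using hIw'
  choose K hK using fun x => exists_absDetDelta_eq_zpow F E c hcδ hδ hd v n hT₀ hJD (hpI x)
  choose K' hK' using fun x => exists_absDetDelta_eq_zpow F E c hcδ hδ hd v n hT₀ hJD (hpI' x)
  have hq0 : residueFieldCard (v.adicCompletion F) ≠ 0 := residueFieldCard_ne_zero _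
  have hq1 : (1 : ℝ) < residueFieldCard (v.adicCompletion F) := by exact_mod_cast one_lt_residueFieldCard (v.adicCompletion F)
  have hqpos : (0 : ℝ) < residueFieldCard (v.adicCompletion F) := lt_trans one_pos hq1
  have hinj : Function.Injective fun m : ℤ => (residueFieldCard (v.adicCompletion F) : ℝ) ^ m := zpow_right_injective₀ hqpos hq1.ne'
  -- the flat families are height powers times the common member at `½`
  have hf : ∀ (s : ℂ) (x : UnitaryGroup.localPi E c (n + n) JD v),
      f s x = ((((residueFieldCard (v.adicCompletion F) : ℝ) ^ K x : ℝ)) : ℂ) ^ (s - 1 / 2) * f (1 / 2) x := fun s x => by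
    have e := apply_eq_cpow_mul_apply F E c hcδ hδ hd v n hT₀ hJD χv hS hfl (hpI x) (hkI x) s (1 / 2)
    rw [← hxI x, hK x] at e
    exact e
  have hf' : ∀ (s : ℂ) (x : UnitaryGroup.localPi E c (n + n) JD v),
      f' s x = ((((residueFieldCard (v.adicCompletion F) : ℝ) ^ K' x : ℝ)) : ℂ) ^ (s - 1 / 2) * f (1 / 2) x := fun s x => by
    have e := apply_eq_cpow_mul_apply F E c hcδ hδ hd v n hT₀ hJD χv hS' hfl' (hpI' x) (hkI' x) s (1 / 2)
    rw [← hxI' x, hK' x, heq] at e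
    exact e
  -- `f′_s = (q^κ)^{s−½} · f_s`, `κ := K′ − K`
  have hff' : ∀ (s : ℂ) (x : UnitaryGroup.localPi E c (n + n) JD v),
      f' s x = ((((residueFieldCard (v.adicCompletion F) : ℝ) ^ (K' x - K x) : ℝ)) : ℂ) ^ (s - 1 / 2) * f s x := fun s x => by
    rw [hf' s x, hf s x, ← mul_assoc, ← Complex.mul_cpow_ofReal_nonneg (zpow_nonneg hqpos.le _) (zpow_nonneg hqpos.le _), ← Complex.ofReal_mul,
      ← zpow_add₀ hqpos.ne', sub_add_cancel]
  -- invariances of `κ`: right `K₀ ∩ K₀′`, left `P_Δ`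
  have hKk : ∀ (x k : UnitaryGroup.localPi E c (n + n) JD v), k ∈ K₀ → K (x * k) = K x := fun x k hk => by
    apply hinj
    simp only
    rw [← hK, ← hK]
    exact absDetDelta_eq_of_mul_eq_mul F E c hcδ hδ hd v n hT₀ hJD K₀ hK₀.1 (hpI (x * k)) (hpI x) (hkI (x * k)) (K₀.mul_mem (hkI x) hk)
      (by rw [← mul_assoc, ← hxI x]; exact (hxI (x * k)).symm)
  have hK'k : ∀ (x k : UnitaryGroup.localPi E c (n + n) JD v), k ∈ K₀' → K' (x * k) = K' x := fun x k hk => by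
    apply hinj
    simp only
    rw [← hK', ← hK']
    exact absDetDelta_eq_of_mul_eq_mul F E c hcδ hδ hd v n hT₀ hJD K₀' hK₀'.1 (hpI' (x * k)) (hpI' x) (hkI' (x * k)) (K₀'.mul_mem (hkI' x) hk)
      (by rw [← mul_assoc, ← hxI' x]; exact (hxI' (x * k)).symm)
  have hκk : ∀ (x k : UnitaryGroup.localPi E c (n + n) JD v), k ∈ K₀ → k ∈ K₀' → K' (x * k) - K (x * k) = K' x - K x := fun x k hk hk' => by
    rw [hKk x k hk, hK'k x k hk']
  have hκP : ∀ (p x : UnitaryGroup.localPi E c (n + n) JD v), IsSiegelDelta F E c hcδ hδ hd v n hT₀ hJD p → K' (p * x) - K (p * x) = K' x - K x := by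
    intro p x hp
    obtain ⟨m, hm⟩ := exists_absDetDelta_eq_zpow F E c hcδ hδ hd v n hT₀ hJD hp
    have e1 : K (p * x) = m + K x := by
      apply hinj
      simp only
      rw [← hK, zpow_add₀ hqpos.ne', ← hm, ← hK, ← absDetDelta_mul F E c hcδ hδ hd v n hT₀ hJD p (pI x) (hpI x)]
      exact absDetDelta_eq_of_mul_eq_mul F E c hcδ hδ hd v n hT₀ hJD K₀ hK₀.1 (hpI (p * x)) (hp.mul (hpI x)) (hkI (p * x)) (hkI x)
        (by rw [mul_assoc, ← hxI x]; exact (hxI (p * x)).symm)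
    have e2 : K' (p * x) = m + K' x := by
      apply hinj
      simp only
      rw [← hK', zpow_add₀ hqpos.ne', ← hm, ← hK', ← absDetDelta_mul F E c hcδ hδ hd v n hT₀ hJD p (pI' x) (hpI' x)]
      exact absDetDelta_eq_of_mul_eq_mul F E c hcδ hδ hd v n hT₀ hJD K₀' hK₀'.1 (hpI' (p * x)) (hp.mul (hpI' x)) (hkI' (p * x)) (hkI' x)
        (by rw [mul_assoc, ← hxI' x]; exact (hxI' (p * x)).symm)
    rw [e1, e2]; ring
  -- `κ` is locally constant, so it takes finitely many values on the compact `K₀′`, hence on `H_v = P_Δ · K₀′`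
  have hopen : ∀ x : UnitaryGroup.localPi E c (n + n) JD v, IsOpen {z : UnitaryGroup.localPi E c (n + n) JD v | K' z - K z = K' x - K x} := by
    intro x
    rw [isOpen_iff_forall_mem_open]
    intro z hz
    refine ⟨(fun k => z * k) '' ((K₀ : Set (UnitaryGroup.localPi E c (n + n) JD v)) ∩ K₀'), ?_,
      (Homeomorph.mulLeft z).isOpenMap _ (hK₀.2.inter hK₀'.2), ⟨1, ⟨K₀.one_mem, K₀'.one_mem⟩, mul_one z⟩⟩
    rintro _ ⟨k, ⟨hk, hk'⟩, rfl⟩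
    show K' (z * k) - K (z * k) = K' x - K x
    rw [hκk z k hk hk']
    exact hz
  have hlc : IsLocallyConstant fun z : UnitaryGroup.localPi E c (n + n) JD v => K' z - K z :=
    (IsLocallyConstant.iff_exists_open _).2 fun x => ⟨_, hopen x, rfl, fun _ hz => hz⟩
  have hfin : ((fun z : UnitaryGroup.localPi E c (n + n) JD v => K' z - K z) '' (K₀' : Set (UnitaryGroup.localPi E c (n + n) JD v))).Finite :=
    (hK₀'.1.image hlc.continuous).finite_of_discrete
  obtain ⟨S, hS_eq⟩ : ∃ S : Finset ℤ, ∀ j, j ∈ S ↔ j ∈ (fun z : UnitaryGroup.localPi E c (n + n) JD v => K' z - K z) '' (K₀' : Set (UnitaryGroup.localPi E c (n + n) JD v)) :=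
    ⟨hfin.toFinset, fun j => hfin.mem_toFinset⟩
  have hmemS : ∀ x : UnitaryGroup.localPi E c (n + n) JD v, K' x - K x ∈ S := fun x => by
    rw [hS_eq]
    refine ⟨kI' x, hkI' x, ?_⟩
    show K' (kI' x) - K (kI' x) = K' x - K x
    rw [← hκP (pI' x) (kI' x) (hpI' x), ← hxI' x]
  -- the pieces `f^j := f · 𝟙_{κ = j}`: again `K₀`-flat smooth Siegel families
  have hPS : ∀ j : ℤ, ∀ s, IsLocalSiegelSection F E c hcδ hδ hd v n hT₀ hJD χv s (fun x => if K' x - K x = j then f s x else 0) := by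
    intro j s p hp x
    show (if K' (p * x) - K (p * x) = j then f s (p * x) else 0) = localSiegelCharacter F E c v n χv s p * (if K' x - K x = j then f s x else 0)
    rw [hκP p x hp, hS s p hp x]
    split_ifs
    · rfl
    · rw [mul_zero]
  have hPsm : ∀ j : ℤ, ∀ s, IsSmooth F E c v n (fun x => if K' x - K x = j then f s x else 0) := by
    intro j s
    obtain ⟨U, hU⟩ := hsm s
    refine ⟨U ⊓ ⟨K₀ ⊓ K₀', hK₀.2.inter hK₀'.2⟩, fun x u hu => ?_⟩
    have huU : u ∈ (U : Subgroup (UnitaryGroup.localPi E c (n + n) JD v)) := (Subgroup.mem_inf.1 hu).1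
    have huK : u ∈ K₀ ⊓ K₀' := (Subgroup.mem_inf.1 hu).2
    show (if K' (x * u) - K (x * u) = j then f s (x * u) else 0) = if K' x - K x = j then f s x else 0
    rw [hκk x u (Subgroup.mem_inf.1 huK).1 (Subgroup.mem_inf.1 huK).2, hU x u huU]
  have hPfl : ∀ j : ℤ, ∀ s s' : ℂ, ∀ k ∈ K₀, (fun x => if K' x - K x = j then f s x else 0) k = (fun x => if K' x - K x = j then f s' x else 0) k := by
    intro j s s' k hk
    show (if K' k - K k = j then f s k else 0) = if K' k - K k = j then f s' k else 0
    rw [hfl s s' k hk]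
  choose Fnj hFnj_reg hFnj_fac using fun j : ℤ => hA4R (fun s x => if K' x - K x = j then f s x else 0) (hPS j) (hPsm j) (hPfl j)
  -- the two decompositions and ★ V1 `value_eq_sum`
  have hcj : ∀ j ∈ S, IsQRationalRegularAt (residueFieldCard (v.adicCompletion F)) (1 / 2)
      (fun s : ℂ => ((((residueFieldCard (v.adicCompletion F) : ℝ) ^ j : ℝ)) : ℂ) ^ (s - 1 / 2)) := fun j _ =>
    (isQRationalRegularAt_zpow_cpow_add hq0 j (-(1 / 2)) (1 / 2)).congr fun s => by rw [← sub_eq_add_neg]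
  have hint : ∀ j ∈ S, ∀ s : ℂ, 1 < s.re →
      Integrable (fun u : unipDeltaLocal F E c v n (JD := JD) => (fun s x => if K' x - K x = j then f s x else 0) s
        (weylDelta F E c v n hJD * (u : UnitaryGroup.localPi E c (n + n) JD v) * h)) νN := fun j _ s hs =>
    hintA _ (hPS j) (hPsm j) (hPfl j) s hs h
  have hsum' : ∀ s : ℂ, 1 < s.re → ∀ x : UnitaryGroup.localPi E c (n + n) JD v,
      f' s x = ∑ j ∈ S, ((((residueFieldCard (v.adicCompletion F) : ℝ) ^ j : ℝ)) : ℂ) ^ (s - 1 / 2) *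
        (fun s x => if K' x - K x = j then f s x else 0) s x := fun s _ x => by
    show f' s x = ∑ j ∈ S, ((((residueFieldCard (v.adicCompletion F) : ℝ) ^ j : ℝ)) : ℂ) ^ (s - 1 / 2) * (if K' x - K x = j then f s x else 0)
    simp_rw [mul_ite, mul_zero]
    rw [Finset.sum_ite_eq S (K' x - K x), if_pos (hmemS x), hff' s x]
  have hsum : ∀ s : ℂ, 1 < s.re → ∀ x : UnitaryGroup.localPi E c (n + n) JD v,
      f s x = ∑ j ∈ S, (fun (_ : ℤ) (_ : ℂ) => (1 : ℂ)) j s * (fun s x => if K' x - K x = j then f s x else 0) s x := fun s _ x => by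
    show f s x = ∑ j ∈ S, (1 : ℂ) * (if K' x - K x = j then f s x else 0)
    simp_rw [one_mul]
    rw [Finset.sum_ite_eq S (K' x - K x), if_pos (hmemS x)]
  have h1 := value_eq_sum F E c v n hJD νN χv vol haN S _ hcj _ Fnj h (fun j _ => hFnj_reg j h) (fun j _ s hs => hFnj_fac j s hs h) hint f' hsum'
    (fun s => Fn' s h) (hreg' h) (fun s hs => hfac' s hs h)
  have h2 := value_eq_sum F E c v n hJD νN χv vol haN S (fun (_ : ℤ) (_ : ℂ) => (1 : ℂ)) (fun _ _ => isQRationalRegularAt_const _ _ _) _ Fnj h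
    (fun j _ => hFnj_reg j h) (fun j _ s hs => hFnj_fac j s hs h) hint f hsum (fun s => Fn s h) (hreg h) (fun s hs => hfac s hs h)
  rw [h1, h2]
  refine Finset.sum_congr rfl fun j _ => ?_
  rw [sub_self, Complex.cpow_zero]

end Summit.HodgeConjecture.HodgeConjecture.Cruxes.HLiu418.K2LiuA7ValueLevelIndependence

end
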